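import Summits.QuantumFields.BalabanUV.T4Continuum.Support.VariationalVectorGaugeSliceFlat
import Summits.QuantumFields.BalabanUV.T4Continuum.Support.VariationalVectorEffective
import Literature.MathematicalPhysics.QuantumFieldTheory.Balaban1983to89.B5DeltaA169

/-!
# T⁴ programme, spine node NE2 (U1a), lane P2 — LEAF V-GF, file 3: THE MATRIX-WORLD BRIDGE AND LEAF V-P AT `U = 1` FOR BAŁABAN's GAUGE FUNCTIONAL —
# on `1^⊥`, pv15's typed `I − P` ([B5] (1.26)/(1.70)) IS the `ℓ²`-orthogonal projection onto the road's slice subspace `div_1 D_1 (ker Q′_1)`; the quadratic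
# form of `Δ_a` (1.69) on an uncurried 1-form is `n^d·(ScV n M 1 projG W + a·nsqV (Q_1 W))`; hence (1.90) `Δ_a ≥ γ(Δ + I)` (kernel pass 6) gives
# `qWV ≤ (d+1)·Cst(d,a)·(ScV + a·nsqV(Q_1 W))` — the `hPc` binder, binder-free and k-uniform, at flat data (model level, `E = ℂ`)

NE2 formalisation swarm `b2b-balaban-t4-ne2-formalise-*`, leaf prover 09 GEN 7 (`prover-b2b-balaban-t4-ne2-formalise-leaf-09-g7-0`); journal INTENT
CLAIMS.log 2026-08-20 «V-GF AT U = 1», file 3.  On top of files 1–2 of this leaf (`VariationalVectorGaugeSlice{,Flat}`: `projG`, `sliceSub`, `lapOp`,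
`kerAvgFlat`), the road's `VariationalVectorEffective.unc` (p216485) and — BY NAME, kernel-certified Literature passes of the cell — pv15's
`B5Value126.{PcT, lambda0, QsOp_lambda0, residual_lambda0, PcT_mul_PcT, PcT_conjTranspose, one_sub_PcT_proj}` (p. 22), `B5LaplaceInverse.LapSinv_LapS_of_orth`,
`B5Action121.{GradOp, CurlOp, divS, LapS, form_CurlOp}`, `B5Block118.{QvOp, QsOp}`, `B5DeltaA169.{DeltaA, DeltaA_eq_curl, calDa_eq_DeltaA, QvAdj}` (b05),
`B5Prop11Lower.{lowerBound_re, form_LapOne, Cst}` (pass 6: (1.90) with OUR constant `1/((d+1)·Cst(d,a))`).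

THE STATEMENTS (model level; `E = ℂ`; level `n ≥ 1` = B5's `η⁻¹`, coarse torus `Tor M`, fine torus `T_η = Tor (fine n M)`; FLAT data `flatR = 1`; `K = ker Q′_1`).
 * §1 DICTIONARY (lattice factor `c = n`): `divS n (unc W) = n·div_1 W` (`GradOpH_unc`), `Σ_x div_1 W = 0`, `QsOp *ᵥ f = Q′_1 f` (`QsOp_mulVec_eq_Qcv`,
   `mem_kerAvgFlat_iff`), `LapS n *ᵥ f = n²·(div_1 D_1) f` (`LapS_mulVec_eq_lapOp`), `Fs n (unc W) = n·curl_1 W` (`Fs_unc`), `QvOp *ᵥ unc W = unc (Q_1 W)`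
   (`QvOp_unc`: (1.18) IS the road's flat line-sum average), `nsq (unc W) = nsqV W`;
 * §2 **THE KEY LEMMA `one_sub_PcT_eq_starProjection`**: for `b ⊥ 1`, `Π_{S}(b) = (I − PcT)b` with `S = sliceSub 1 (ker Q′_1) = div_1D_1(ker Q′_1)` read in `ℓ²`
   — membership by (1.25)'s `λ₀` (`Q′λ₀ = 0`, `b − Δλ₀ = Pb`: pv15), orthogonality by `Pᴴ = P` and `PΔλ = 0` for `Q′λ = 0` (`PcT_LapS_of_ker`); so file 1's
   READING «`I − P = Π_{Δ(ker Q′)}`» is now KERNEL for the typed `PcT` on divergences, and **`projG_flat_eq_nsq`**: `projG 1 K W = Σ_x|((I − P)div_1 W)(x)|²`;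
 * §3 **`form_DeltaA_unc`**: `⟨unc W, Δ_a unc W⟩ = n^d·( ScV n M 1 (projG 1 K) W + a·nsqV M (Q_1 W) )` — (1.69)'s first form `½‖∂A‖² + ⟨∂*A, R∂*A⟩ + a⟨QA,QA⟩`
   term by term (`form_curl_unc`, `form_gauge_unc` via `form_of_projection`, `form_avg_unc` with `Q* = n^d·Qᴴ`);
 * §4 **`qWV_le_flat`** (`a > 0`) ∕ **`hPc_flat`** (`a = 1`): `qWV n M W ≤ (d+1)·Cst(d,a)·(ScV n M 1 (projG 1 K) W + a·nsqV M (Q_1 W))` — LEAF V-P AT `U = 1` for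
   Bałaban's gauge functional, in the exact shape of the END's `hPc k` (`towerLimitRate_effV_of_leaves`, p220074) at flat data, with NO displayed binder and a
   constant depending on `d` (and `a`) only; **`garding_flat`**: `n^{−d}(n²·roughV_1 W) ≤` the same — the (Går) input of `VariationalVectorPoincare.qWV_le_of_garding`
   and, with `divSq ≤ d·rough` (p218860), the (GF3) divergence control at `U = 1`; `nsq_le_form_LapOne`, `rough_le_form_LapOne` (the two summands of `Δ + I`).
So at `U = 1` BOTH binders the END puts on `G` hold in the kernel for `G := projG 1 (ker Q′_1)`: (SLICE) with `σ′ = σ = 0` (file 2) and V-P∕(Går)∕(GF3) (here).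
NOT HERE: background (`U ≠ 1`); the END's matrix∕`Gtr` plumbing for `projG`; the `hPf` (fine-level) twin is the same statement one level up.

HONEST FRAMING (T4-DAG p. 1).  Model level (`E = ℂ`, flat data); [folklore] linear algebra over kernel-certified Literature passes (the analytic input is (1.90) as
certified in `B5Prop11Lower` with ITS constant `Cst(d,a) = max(γ₀(d,a), 1/a, 1)` — no value of B5's `γ₀` is attributed to the paper); nothing printed is a
hypothesis; one `abbrev` (`flatR := 1`), no `def … : Prop`, no `sorry`; axioms standard.  V-GF ∕ V-P with background OPEN; V-END ∕ NE2 NOT proved; NE3 OPEN; spine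
PROVED 0∕9 unchanged; rung (B)+1 finite T⁴ — NOT infinite volume, NOT mass gap, NOT Clay.  HONEST DEPENDENCY (cell, verbatim): continuum YM on T⁴ ⇐ BetaPertH ∧ nine
spine estimates (0/9 proved); BetaPertH ⇐ (D1) ∧ (D4) ∧ CAP+tail; G-an2-4 gates asym, D1 and NE2/3/4.
-/

noncomputable section

namespace Summit.QuantumFields.BalabanUV.T4Continuum.VariationalVectorGaugeSliceB5

open Finset WithLp Matrix
open scoped InnerProductSpace ComplexConjugate Matrix
open Literature.MathematicalPhysics.QuantumFieldTheory.Balaban1983to89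
open Literature.MathematicalPhysics.QuantumFieldTheory.Balaban1983to89.B5Prop11Plancherel (Tor fine unitVec fdiff Cst)
open Literature.MathematicalPhysics.QuantumFieldTheory.Balaban1983to89.B5Block118 (tstep bpt QvOp QsOp QvOp_mulVec QsOp_mulVec lineSum)
open Literature.MathematicalPhysics.QuantumFieldTheory.Balaban1983to89.B5Action121
  (sdiff LapS GradOp CurlOp Fs divS comp sdiff_mulVec sdiff_conjTranspose_mulVec LapS_mulVec Fs_apply divS_apply
    GradOp_conjTranspose_mulVec_eq form_CurlOp form_gram_rect fdiff_mulVec_apply)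
open Literature.MathematicalPhysics.QuantumFieldTheory.Balaban1983to89.B5LaplaceInverse (LapSinv LapSinv_LapS_of_orth)
open Literature.MathematicalPhysics.QuantumFieldTheory.Balaban1983to89.B5Value126
  (PcT PcT_mulVec PcT_mul_PcT PcT_conjTranspose one_sub_PcT_proj lambda0 lambda0_eq_LapSinv QsOp_lambda0 residual_lambda0)
open Literature.MathematicalPhysics.QuantumFieldTheory.Balaban1983to89.B5Prop11Lower (nsq nsq_nonneg star_dotProduct_self Lap Vb form_LapOne form_gram lowerBound_re)
open Literature.MathematicalPhysics.QuantumFieldTheory.Balaban1983to89.B5DeltaA169 (QvAdj DeltaA DeltaA_eq_curl calDa_eq_DeltaA)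
open Literature.MathematicalPhysics.QuantumFieldTheory.Balaban1983to89.B5Projection127 (form_of_projection)
open Summit.QuantumFields.BalabanUV.T4Continuum.VariationalColourFederbush (cDv Qcv)
open Summit.QuantumFields.BalabanUV.T4Continuum.VariationalVectorWeitzenbock (divV divSq divV_apply)
open Summit.QuantumFields.BalabanUV.T4Continuum.VariationalVectorForm (cdV curlV curlSq ScV qWV)
open Summit.QuantumFields.BalabanUV.T4Continuum.VectorBlockTrialForm (QvL nsqV roughV)
open Summit.QuantumFields.BalabanUV.T4Continuum.VariationalVectorEffective (unc cur nsq_unc)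
open Summit.QuantumFields.BalabanUV.T4Continuum.VariationalVectorGaugeSlice
open Summit.QuantumFields.BalabanUV.T4Continuum.VariationalVectorGaugeSliceFlat (kerAvgFlat)

variable {d : ℕ} (n : ℕ) [NeZero n] (M : Fin d → ℕ) [hM : ∀ μ, NeZero (M μ)]

/-- the flat bond transports at `E = ℂ`. [folklore] -/
abbrev flatR : Tor (fine n M) → Fin d → (ℂ →L[ℂ] ℂ) := fun _ _ => 1

/-! ## §1 The dictionary: B5's position-space matrices on `T_η` (lattice factor `c = η⁻¹ = n`) act on uncurried flat-data objects of the road -/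

section Dictionary

/-- `∂* = (∂)ᴴ` on an uncurried 1-form is `n ×` the flat covariant divergence: `divS n (unc W) = n • div_1 W`. [folklore] -/
theorem divS_unc (W : Tor (fine n M) → Fin d → ℂ) :
    divS (fine n M) (n : ℂ) (unc W) = fun x => (n : ℂ) * divV (fine n M) (flatR n M) W x := by
  funext x
  rw [divS_apply, divV_apply, mul_sum]
  refine sum_congr rfl fun μ _ => ?_
  simp only [unc, Complex.conj_natCast, star_one, one_apply_eq_self]

/-- `(∂)ᴴ (unc W) = n • div_1 W`. [folklore] -/
theorem GradOpH_unc (W : Tor (fine n M) → Fin d → ℂ) :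
    (GradOp (fine n M) (n : ℂ))ᴴ *ᵥ unc W = fun x => (n : ℂ) * divV (fine n M) (flatR n M) W x := by
  rw [GradOp_conjTranspose_mulVec_eq, divS_unc]

/-- the flat divergence has zero total sum (every bond enters twice with opposite signs). [folklore] -/
theorem sum_divV_flat (W : Tor (fine n M) → Fin d → ℂ) : ∑ x, divV (fine n M) (flatR n M) W x = 0 := by
  simp only [divV_apply, star_one, one_apply_eq_self]
  rw [sum_comm]
  refine sum_eq_zero fun μ _ => ?_
  rw [sum_sub_distrib, sub_eq_zero]
  exact (Equiv.subRight (unitVec (fine n M) μ)).sum_comp (fun x => W x μ)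

/-- B5's `Q′_k` IS the flat block mean `Q′_1`: `QsOp *ᵥ f = Qcv n M 1 f`. [folklore] -/
theorem QsOp_mulVec_eq_Qcv (f : Tor (fine n M) → ℂ) : QsOp n M *ᵥ f = Qcv n M (fun _ => (1 : ℂ →L[ℂ] ℂ)) f := by
  funext y
  rw [QsOp_mulVec]
  simp only [Qcv, one_apply_eq_self, smul_eq_mul, one_div]

/-- membership in the road's block-mean kernel is `Q′_k λ = 0`. [folklore] -/
theorem mem_kerAvgFlat_iff (f : Tor (fine n M) → ℂ) : f ∈ kerAvgFlat n M ↔ QsOp n M *ᵥ f = 0 := by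
  rw [QsOp_mulVec_eq_Qcv]; exact LinearMap.mem_ker

/-- a block-mean-free field has zero total sum. [folklore] -/
theorem sum_eq_zero_of_QsOp {f : Tor (fine n M) → ℂ} (hf : QsOp n M *ᵥ f = 0) : ∑ x, f x = 0 := by
  have h := B5Blocks16.sum_QsOp n M f
  rw [hf] at h
  simp only [Pi.zero_apply, sum_const_zero] at h
  have hn : (1 / (n : ℂ) ^ d) ≠ 0 := one_div_ne_zero (pow_ne_zero _ (by exact_mod_cast NeZero.ne n))
  exact (mul_eq_zero.mp h.symm).resolve_left hn

/-- B5's `Δ` on scalars (`c = n`) IS `n² ×` the road's flat `div_1 D_1`: `LapS n *ᵥ f = n² • lapOp 1 f`. [folklore] -/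
theorem LapS_mulVec_eq_lapOp (f : Tor (fine n M) → ℂ) :
    LapS (fine n M) (n : ℂ) *ᵥ f = fun x => (n : ℂ) ^ 2 * lapOp (fine n M) (flatR n M) f x := by
  funext x
  rw [LapS_mulVec, lapOp_apply, divV_apply, mul_sum]
  refine sum_congr rfl fun ν _ => ?_
  simp only [cDv, Complex.conj_natCast, star_one, one_apply_eq_self, sub_add_cancel]
  ring

/-- the plaquette field of an uncurried flat 1-form: `F_{μν}(x) = n · (curl_1 W)_{μν}(x)`. [folklore] -/
theorem Fs_unc (W : Tor (fine n M) → Fin d → ℂ) (μ ν : Fin d) (x : Tor (fine n M)) :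
    Fs (fine n M) (n : ℂ) (unc W) μ ν x = (n : ℂ) * curlV (fine n M) (flatR n M) W x μ ν := by
  rw [Fs_apply]
  simp only [unc, curlV, cdV, one_apply_eq_self]
  ring

/-- B5's (1.18) average IS the road's flat line-sum average: `QvOp *ᵥ unc W = unc (QvL n M 1 W)`. [folklore] -/
theorem QvOp_unc (W : Tor (fine n M) → Fin d → ℂ) :
    QvOp n M *ᵥ unc W = unc (QvL n M (fun _ _ _ _ => (1 : ℂ →L[ℂ] ℂ)) W) := by
  funext ⟨y, μ⟩
  rw [QvOp_mulVec]
  simp only [unc, QvL, lineSum, one_apply_eq_self, smul_eq_mul, one_div]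

/-- `nsq (unc φ) = nsqV φ` on the fine torus as well. [folklore] -/
theorem nsq_unc_fine (W : Tor (fine n M) → Fin d → ℂ) : nsq (unc W) = nsqV (fine n M) W := by
  unfold nsq nsqV unc
  rw [Fintype.sum_prod_type]

end Dictionary

/-! ## §2 THE KEY LEMMA: on `1^⊥`, B5's `I − P` ((1.26)/(1.70)) IS the `ℓ²`-orthogonal projection onto `Δ(ker Q′)` = the road's slice subspace -/

section Projection

/-- `P(Δλ) = 0` for `Q′λ = 0` («`RΔ⁻¹Q′* = 0`» read backwards: `PΔ` kills `ker Q′`). [folklore] -/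
theorem PcT_LapS_of_ker {f : Tor (fine n M) → ℂ} (hf : QsOp n M *ᵥ f = 0) :
    PcT n M (n : ℂ) *ᵥ (LapS (fine n M) (n : ℂ) *ᵥ f) = 0 := by
  have hn : (n : ℂ) ≠ 0 := by exact_mod_cast NeZero.ne n
  rw [PcT_mulVec, LapSinv_LapS_of_orth (fine n M) hn f (sum_eq_zero_of_QsOp n M hf), hf, Matrix.mulVec_zero, Matrix.mulVec_zero,
    Matrix.mulVec_zero]

/-- `(I − P)b ∈ Δ(ker Q′)` for `b ⊥ 1`: the witness is (1.25)'s `λ₀` (`Q′λ₀ = 0`, `b − Δλ₀ = Pb`). [folklore] -/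
theorem one_sub_PcT_mem {b : Tor (fine n M) → ℂ} (hb : ∑ x, b x = 0) :
    (1 - PcT n M (n : ℂ)) *ᵥ b ∈ (kerAvgFlat n M).map (lapOp (fine n M) (flatR n M)) := by
  have hn : (n : ℂ) ≠ 0 := by exact_mod_cast NeZero.ne n
  refine Submodule.mem_map.mpr ⟨((n : ℂ) ^ 2) • lambda0 n M (n : ℂ) b, ?_, ?_⟩
  · rw [mem_kerAvgFlat_iff, Matrix.mulVec_smul, QsOp_lambda0 n M (n : ℂ) hn, smul_zero]
  · rw [map_smul]
    have h := residual_lambda0 n M (n : ℂ) hn b hb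
    rw [LapS_mulVec_eq_lapOp] at h
    funext x
    have hx := congrFun h x
    simp only [Pi.sub_apply] at hx
    simp only [Pi.smul_apply, smul_eq_mul, Matrix.sub_mulVec, Matrix.one_mulVec, Pi.sub_apply]
    linear_combination (-1 : ℂ) * hx

/-- `Pb ⊥ Δ(ker Q′)`: `⟪Δλ, Pb⟫ = ⟪λ, ΔPb⟫`… realised as `star (Pb) ⬝ᵥ (lapOp 1 λ) = 0` (`Pᴴ = P`, `PΔλ = 0`). [folklore] -/
theorem star_PcT_dotProduct_lapOp {f : Tor (fine n M) → ℂ} (hf : QsOp n M *ᵥ f = 0) (b : Tor (fine n M) → ℂ) :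
    star (PcT n M (n : ℂ) *ᵥ b) ⬝ᵥ lapOp (fine n M) (flatR n M) f = 0 := by
  have hn2 : ((n : ℂ) ^ 2) ≠ 0 := pow_ne_zero _ (by exact_mod_cast NeZero.ne n)
  have hlap : lapOp (fine n M) (flatR n M) f = ((n : ℂ) ^ 2)⁻¹ • (LapS (fine n M) (n : ℂ) *ᵥ f) := by
    rw [LapS_mulVec_eq_lapOp]; funext x; simp [hn2]
  rw [hlap, dotProduct_smul, Matrix.star_mulVec, PcT_conjTranspose, ← dotProduct_mulVec, PcT_LapS_of_ker n M hf, dotProduct_zero,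
    smul_zero]

/-- **THE KEY LEMMA**: for `b ⊥ 1`, `(I − P)b` IS the `ℓ²`-orthogonal projection of `b` onto the road's slice subspace `div_1 D_1 (ker Q′_1)` —
B5's `R = I − P` of (1.69)/(1.70) is `Π_{Δ(ker Q′)}` (on divergences). [folklore] -/
theorem one_sub_PcT_eq_starProjection {b : Tor (fine n M) → ℂ} (hb : ∑ x, b x = 0) :
    (sliceSub (fine n M) (flatR n M) (kerAvgFlat n M)).starProjection (toLp 2 b) = toLp 2 ((1 - PcT n M (n : ℂ)) *ᵥ b) := by
  refine Submodule.eq_starProjection_of_mem_of_inner_eq_zero ?_ ?_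
  · exact (mem_sliceSub (fine n M) _).mpr (one_sub_PcT_mem n M hb)
  · intro w hw
    obtain ⟨f, hfK, hf⟩ := Submodule.mem_map.mp ((mem_sliceSub (fine n M) w).mp hw)
    have hw' : w = toLp 2 (lapOp (fine n M) (flatR n M) f) := by rw [hf, toLp_ofLp]
    have hsub : toLp 2 b - toLp 2 ((1 - PcT n M (n : ℂ)) *ᵥ b) = toLp (2 : ENNReal) (PcT n M (n : ℂ) *ᵥ b) := by
      rw [← toLp_sub, Matrix.sub_mulVec, Matrix.one_mulVec, sub_sub_cancel]
    rw [hsub, hw', EuclideanSpace.inner_toLp_toLp, dotProduct_comm]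
    exact star_PcT_dotProduct_lapOp n M ((mem_kerAvgFlat_iff n M f).mp hfK) b

/-- hence **`projG 1 (ker Q′_1) W = Σ_x |((I − P)div_1 W)(x)|²`** — Bałaban's `‖R∂*A‖²` at unit lattice factor. [folklore] -/
theorem projG_flat_eq_nsq (W : Tor (fine n M) → Fin d → ℂ) :
    projG (fine n M) (flatR n M) (kerAvgFlat n M) W = nsq ((1 - PcT n M (n : ℂ)) *ᵥ divV (fine n M) (flatR n M) W) := by
  unfold projG
  rw [one_sub_PcT_eq_starProjection n M (sum_divV_flat n M W), norm_toLp_sq]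
  rfl

end Projection

/-! ## §3 The quadratic form of `Δ_a` on an uncurried 1-form in the road's letters -/

section Form

variable (a : ℝ)

/-- the curl term: `⟨A, ½(∂)ᴴ∂ A⟩ = ½·n²·curlSq_1 W`. [folklore] -/
theorem form_curl_unc (W : Tor (fine n M) → Fin d → ℂ) :
    star (unc W) ⬝ᵥ (((CurlOp (fine n M) (n : ℂ))ᴴ * CurlOp (fine n M) (n : ℂ)) *ᵥ unc W)
      = (((n : ℝ) ^ 2 * curlSq (fine n M) (flatR n M) W : ℝ) : ℂ) := by
  rw [form_CurlOp]
  congr 1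
  unfold curlSq
  rw [mul_sum]
  refine sum_congr rfl fun x _ => ?_
  rw [mul_sum]
  refine sum_congr rfl fun μ _ => ?_
  rw [mul_sum]
  refine sum_congr rfl fun ν _ => ?_
  rw [Fs_unc, norm_mul, mul_pow, Complex.norm_natCast]

/-- the gauge term: `⟨A, ∂(I − P)∂ᴴ A⟩ = n²·projG 1 (ker Q′_1) W` (`I − P` a Hermitian idempotent, `∂ᴴA = n·div_1 W ⊥ 1`). [folklore] -/
theorem form_gauge_unc (W : Tor (fine n M) → Fin d → ℂ) :
    star (unc W) ⬝ᵥ ((GradOp (fine n M) (n : ℂ) * (1 - PcT n M (n : ℂ)) * (GradOp (fine n M) (n : ℂ))ᴴ) *ᵥ unc W)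
      = (((n : ℝ) ^ 2 * projG (fine n M) (flatR n M) (kerAvgFlat n M) W : ℝ) : ℂ) := by
  have hn : (n : ℂ) ≠ 0 := by exact_mod_cast NeZero.ne n
  set R := (1 - PcT n M (n : ℂ)) with hR
  set b := divV (fine n M) (flatR n M) W
  have hG : (GradOp (fine n M) (n : ℂ))ᴴ *ᵥ unc W = (n : ℂ) • b := by rw [GradOpH_unc]; rfl
  have hRH : Rᴴ = R := by rw [hR, Matrix.conjTranspose_sub, Matrix.conjTranspose_one, PcT_conjTranspose]
  have h1 : star (unc W) ⬝ᵥ ((GradOp (fine n M) (n : ℂ) * R * (GradOp (fine n M) (n : ℂ))ᴴ) *ᵥ unc W)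
      = star ((GradOp (fine n M) (n : ℂ))ᴴ *ᵥ unc W) ⬝ᵥ (R *ᵥ ((GradOp (fine n M) (n : ℂ))ᴴ *ᵥ unc W)) := by
    rw [← Matrix.mulVec_mulVec, ← Matrix.mulVec_mulVec, dotProduct_mulVec, Matrix.star_mulVec, Matrix.conjTranspose_conjTranspose]
  have hnsq : star b ⬝ᵥ (R *ᵥ b) = ((projG (fine n M) (flatR n M) (kerAvgFlat n M) W : ℝ) : ℂ) := by
    rw [← form_of_projection R (one_sub_PcT_proj n M (n : ℂ) hn) hRH, star_dotProduct_self, projG_flat_eq_nsq]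
  rw [h1, hG, Matrix.mulVec_smul, star_smul, smul_dotProduct, dotProduct_smul, hnsq, smul_smul]
  simp only [Complex.star_def, Complex.conj_natCast, smul_eq_mul]
  push_cast
  ring

/-- the averaging term: `⟨A, Q*Q A⟩ = n^d·nsqV (Q_1 W)` (`Q* = n^d·Qᴴ`). [folklore] -/
theorem form_avg_unc (W : Tor (fine n M) → Fin d → ℂ) :
    star (unc W) ⬝ᵥ ((QvAdj n M * QvOp n M) *ᵥ unc W)
      = (((n : ℝ) ^ d * nsqV M (QvL n M (fun _ _ _ _ => (1 : ℂ →L[ℂ] ℂ)) W) : ℝ) : ℂ) := by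
  rw [QvAdj, Matrix.smul_mul, Matrix.smul_mulVec, dotProduct_smul, form_gram_rect, star_dotProduct_self, QvOp_unc, nsq_unc, smul_eq_mul]
  push_cast
  rfl

/-- **THE QUADRATIC FORM OF `Δ_a` IN THE ROAD's LETTERS**: `⟨A, Δ_a A⟩ = n^d·( ScV n M 1 (projG 1 (ker Q′_1)) W + a·nsqV (Q_1 W) )` for `A = unc W`
((1.69) first form: `½‖∂A‖² + ‖R∂*A‖² + a‖QA‖²`, unit weights, lattice factor `n`). [folklore] -/
theorem form_DeltaA_unc (W : Tor (fine n M) → Fin d → ℂ) :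
    star (unc W) ⬝ᵥ (DeltaA n M a *ᵥ unc W)
      = (((n : ℝ) ^ d * (ScV n M (flatR n M) (projG (fine n M) (flatR n M) (kerAvgFlat n M)) W
          + a * nsqV M (QvL n M (fun _ _ _ _ => (1 : ℂ →L[ℂ] ℂ)) W)) : ℝ) : ℂ) := by
  have hn : (n : ℝ) ≠ 0 := by exact_mod_cast NeZero.ne n
  have key : (n : ℝ) ^ d * (ScV n M (flatR n M) (projG (fine n M) (flatR n M) (kerAvgFlat n M)) W
        + a * nsqV M (QvL n M (fun _ _ _ _ => (1 : ℂ →L[ℂ] ℂ)) W))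
      = (1 / 2) * ((n : ℝ) ^ 2 * curlSq (fine n M) (flatR n M) W) + (n : ℝ) ^ 2 * projG (fine n M) (flatR n M) (kerAvgFlat n M) W
        + a * ((n : ℝ) ^ d * nsqV M (QvL n M (fun _ _ _ _ => (1 : ℂ →L[ℂ] ℂ)) W)) := by
    unfold ScV
    field_simp
  rw [DeltaA_eq_curl, Matrix.add_mulVec, Matrix.add_mulVec, dotProduct_add, dotProduct_add, Matrix.smul_mulVec, dotProduct_smul,
    Matrix.smul_mulVec, dotProduct_smul, form_curl_unc, form_gauge_unc, form_avg_unc, key]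
  simp only [smul_eq_mul]
  push_cast
  ring

end Form

/-! ## §4 LEAF V-P AT `U = 1` FOR BAŁABAN's GAUGE FUNCTIONAL, from (1.90) `Δ_a ≥ γ(Δ + I)` (B5 Prop. 1.1, kernel pass 6 `B5Prop11Lower`) -/

section Poincare

variable (a : ℝ)

/-- `nsq A ≤ ⟨A, (Δ + I)A⟩` (the `I` summand of `Σ_α V_αᴴV_α`). [folklore] -/
theorem nsq_le_form_LapOne (A : Tor (fine n M) × Fin d → ℂ) :
    nsq A ≤ (star A ⬝ᵥ ((Lap n M + 1) *ᵥ A)).re := by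
  rw [form_LapOne, Complex.ofReal_re, Fintype.sum_option]
  have h0 : ∀ ν, 0 ≤ nsq (Vb n M (some ν) *ᵥ A) := fun ν => nsq_nonneg _
  have : nsq (Vb n M none *ᵥ A) = nsq A := by simp [Vb]
  rw [this]
  linarith [sum_nonneg fun ν (_ : ν ∈ univ) => h0 ν]

/-- `n²·roughV_1 W ≤ ⟨A, (Δ + I)A⟩` (the `∇_ν` summands: `‖∇_ν A‖² = n²Σ_{x,κ}|W(x+e_ν,κ) − W(x,κ)|²`). [folklore] -/
theorem rough_le_form_LapOne (W : Tor (fine n M) → Fin d → ℂ) :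
    (n : ℝ) ^ 2 * roughV n M (flatR n M) W ≤ (star (unc W) ⬝ᵥ ((Lap n M + 1) *ᵥ unc W)).re := by
  rw [form_LapOne, Complex.ofReal_re, Fintype.sum_option]
  have hV : ∀ ν, nsq (Vb n M (some ν) *ᵥ unc W) = (n : ℝ) ^ 2 * ∑ μ, ∑ x, ‖W (x + unitVec (fine n M) ν) μ - W x μ‖ ^ 2 := by
    intro ν
    simp only [Vb, nsq]
    rw [Fintype.sum_prod_type, sum_comm, mul_sum]
    refine sum_congr rfl fun μ _ => ?_
    rw [mul_sum]
    refine sum_congr rfl fun x _ => ?_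
    rw [fdiff_mulVec_apply, sdiff_mulVec, norm_mul, mul_pow, Complex.norm_natCast]
    rfl
  have hrough : (n : ℝ) ^ 2 * roughV n M (flatR n M) W = ∑ ν, nsq (Vb n M (some ν) *ᵥ unc W) := by
    simp only [hV, roughV, one_apply_eq_self, ← mul_sum]
  rw [hrough]
  linarith [nsq_nonneg (Vb n M none *ᵥ unc W)]

/-- **(1.90) READ IN THE ROAD's LETTERS**: `γ·(nsqV W + n²·0 …)` — precisely
`nsqV W ≤ (d+1)·Cst(d,a) · n^d · ( ScV n M 1 (projG 1 (ker Q′_1)) W + a·nsqV (Q_1 W) )` and the same bound for `n²·roughV_1 W`. [folklore] -/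
theorem nsqV_le_of_B5 {a : ℝ} (ha : 0 < a) (W : Tor (fine n M) → Fin d → ℂ) :
    nsqV (fine n M) W ≤ ((d + 1 : ℝ) * Cst d a) * ((n : ℝ) ^ d * (ScV n M (flatR n M) (projG (fine n M) (flatR n M) (kerAvgFlat n M)) W
          + a * nsqV M (QvL n M (fun _ _ _ _ => (1 : ℂ →L[ℂ] ℂ)) W))) ∧
    (n : ℝ) ^ 2 * roughV n M (flatR n M) W ≤ ((d + 1 : ℝ) * Cst d a) * ((n : ℝ) ^ d * (ScV n M (flatR n M) (projG (fine n M) (flatR n M) (kerAvgFlat n M)) W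
          + a * nsqV M (QvL n M (fun _ _ _ _ => (1 : ℂ →L[ℂ] ℂ)) W))) := by
  have hn : 1 ≤ n := Nat.one_le_iff_ne_zero.mpr (NeZero.ne n)
  have hC : 0 < (d + 1 : ℝ) * Cst d a := by
    have := B5Prop11Lower.one_le_Cst (d := d) a
    positivity
  have h := lowerBound_re n hn M a ha (unc W)
  rw [calDa_eq_DeltaA, form_DeltaA_unc, Complex.ofReal_re, one_div, inv_mul_le_iff₀ hC] at h
  exact ⟨(nsq_unc_fine n M W).symm.le.trans ((nsq_le_form_LapOne n M (unc W)).trans h),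
    (rough_le_form_LapOne n M W).trans h⟩

/-- **LEAF V-P AT `U = 1` FOR BAŁABAN's PROJECTED GAUGE FUNCTIONAL — binder-free, k-UNIFORM**: for every level `n`, every torus `M`, every `a > 0`,
`qWV n M W ≤ (d+1)·Cst(d,a) · ( ScV n M 1 (projG 1 (ker Q′_1)) W + a · nsqV M (Q_1 W) )` — the `hPc` binder of the vector bracket
(`VariationalVectorForm.vector_pair_bracket_sqrt` ∕ `VariationalAssemblySlice.…_slice_line`) at flat data with `C_P = (d+1)·Cst(d,a)·max(1,a)`;
from [Balaban1984PropagatorsI] Prop. 1.1 (1.90) as certified in `B5Prop11Lower` (constant OURS, `Cst` of pass 4). [folklore] -/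
theorem qWV_le_flat {a : ℝ} (ha : 0 < a) (W : Tor (fine n M) → Fin d → ℂ) :
    qWV n M W ≤ ((d + 1 : ℝ) * Cst d a) * (ScV n M (flatR n M) (projG (fine n M) (flatR n M) (kerAvgFlat n M)) W
          + a * nsqV M (QvL n M (fun _ _ _ _ => (1 : ℂ →L[ℂ] ℂ)) W)) := by
  have hnd : (0 : ℝ) < (n : ℝ) ^ d := by have := Nat.pos_of_ne_zero (NeZero.ne n); positivity
  have h := (nsqV_le_of_B5 n M ha W).1
  unfold qWV
  rw [inv_mul_le_iff₀ hnd]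
  linarith

/-- the same at `a = 1` in the END's exact `hPc k` shape `qWV ≤ C_P·(ScV W + nsqV M (Qk W))`, `C_P = (d+1)·Cst(d,1)`. [folklore] -/
theorem hPc_flat (W : Tor (fine n M) → Fin d → ℂ) :
    qWV n M W ≤ ((d + 1 : ℝ) * Cst d 1) * (ScV n M (flatR n M) (projG (fine n M) (flatR n M) (kerAvgFlat n M)) W
          + nsqV M (QvL n M (fun _ _ _ _ => (1 : ℂ →L[ℂ] ℂ)) W)) := by
  simpa using qWV_le_flat n M one_pos W

/-- **THE GÅRDING INEQUALITY AT `U = 1`** (leaf-01-g5's `qWV_le_of_garding` input ∕ (GF3)'s parent): `n^{−d}·(n²·roughV_1 W) ≤ (d+1)Cst(d,a)·(ScV + a·nsqV(Q_1 W))`.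
[folklore] -/
theorem garding_flat {a : ℝ} (ha : 0 < a) (W : Tor (fine n M) → Fin d → ℂ) :
    ((n : ℝ) ^ d)⁻¹ * ((n : ℝ) ^ 2 * roughV n M (flatR n M) W)
      ≤ ((d + 1 : ℝ) * Cst d a) * (ScV n M (flatR n M) (projG (fine n M) (flatR n M) (kerAvgFlat n M)) W
          + a * nsqV M (QvL n M (fun _ _ _ _ => (1 : ℂ →L[ℂ] ℂ)) W)) := by
  have hnd : (0 : ℝ) < (n : ℝ) ^ d := by have := Nat.pos_of_ne_zero (NeZero.ne n); positivity
  have h := (nsqV_le_of_B5 n M ha W).2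
  rw [inv_mul_le_iff₀ hnd]
  linarith

end Poincare

end Summit.QuantumFields.BalabanUV.T4Continuum.VariationalVectorGaugeSliceB5

end
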